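import Summits.BirchSwinnertonDyer.BirchSwinnertonDyer.Theorems.CongruentShaFreeCutLocNonDegeneracy
import Summits.BirchSwinnertonDyer.BirchSwinnertonDyer.Theorems.CongruentShaFreeCutSelmerFiniteOfRes
import Summits.BirchSwinnertonDyer.BirchSwinnertonDyer.Theorems.CongruentShaFreeCutTwoAdicLinksCorank
import Summits.BirchSwinnertonDyer.BirchSwinnertonDyer.Theorems.CongruentShaFreeCutTwoAdicControlOfSelmerFinite
import Summits.BirchSwinnertonDyer.Rank1Residual.GaloisImage.PropagatedConditionCardEP

set_option autoImplicit false

/-! # Route `CongruentShaFreeCut` (rung S2) — KERNEL CENSUS of the residual crux A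
`RankPosOfTwoSelmerCorankOne` (stmt-BirchSwinnertonDyer-19079) after the v5 cut: modulo Link B,
Poitou–Tate, the W,p-general algebra statement and the refereed facts, crux A ⟺ Skinner's (res) at `2`;
the whole rung-S2 leaf ⟸ {(res) at `2`, Link B} + Poitou–Tate + algebra + refereed facts

Cell `bsd-cn100`; filed by the prover seat `bsd-cn100-s2b-c3` g3 as service for the S2 residual (the S2 twin
of `MordellShaFreeCutResidualCensus`). Supports, does not close, stmt-BirchSwinnertonDyer-19079
(`--supports … --as helper`). HONEST FRAMING: CONDITIONAL reductions; nothing here proves crux A, crux B, the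
leaf `rankOne_twoConverse_congruentNumber`, the congruent number problem or any case of BSD. No research
statement is restated as a definition: (res) at `2` enters as the hypothesis `hres`, spelled EXACTLY as the
registered stub `stub_twoLocNonDegeneracy` of line `heegner-field-links` v5 (skeleton e11896bb); the
W,p-general algebra statement enters as the hypothesis `halg`, spelled EXACTLY as the registered stub
`stub_selmerAcBaseFinite_of_resCorankOne` (CLAIMED by transfer-2 g3; discharged by name in an APPEND once it
lands); Link B by its landed name `CongruentShaFreeCutTwoAdicLinks.TwoAdicCharValueEqHeegnerLogSq` (p424074).

* `twoAdicControlOfCorankOne_of_res_of_poitouTate` — Link A in CORANK currency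
  (`CongruentShaFreeCutTwoAdicLinksCorank.TwoAdicControlOfCorankOne`, p425532) ⟸ (res) at `2` + algebra +
  Poitou–Tate (tower control `hasCharValuationAt_of_finite_selmerAcBase`, p429171; EPC from the tree);
* `cruxA_of_res_of_linkB_of_poitouTate`, **`cruxA_iff_res_of_linkB_of_poitouTate`** — with
  `CongruentShaFreeCutLocNonDegeneracy.twoLocNonDegeneracy_of_cruxA`: modulo Link B + Poitou–Tate + algebra
  + {`2`-parity, modularity, Hoffstein–Luo, Kato, Gross 1984}, crux A is EQUIVALENT to (res) at `2`;
* `leaf_of_res_of_linkB_of_poitouTate` — the rung-S2 leaf `rankOne_twoConverse_congruentNumber` from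
  {(res) at `2`, Link B} + Poitou–Tate + algebra + the six refereed facts (`leaf_of_twoAdicLinks`, p425532).

[cite: Skinner2020, Thm. B and §2.2–2.3 (shape of (res); Lemma 2.3.2)] [cite: CastellaGrossiLeeSkinner2022, §5.2 (proof of Thm. 5.2.1)]
[cite: MilneADT2006, Ch. I, Thm. 4.10(b) and Thm. 2.8] [cite: GrossZagier1986, Thm. I.6.3 with V.§2] -/

noncomputable section

open scoped Classical

namespace Summit.BirchSwinnertonDyer.BirchSwinnertonDyer.Theorems.CongruentShaFreeCutResidualCensus

open WeierstrassCurve NumberField IsDedekindDomain Field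
open Literature.NumberTheory.EllipticCurves Literature.NumberTheory.EllipticCurves.Castella2018
open Literature.NumberTheory.GaloisRepresentations Literature.NumberTheory.GaloisCohomology
open Summit.BirchSwinnertonDyer.Rank1Residual.X11b
open Summit.BirchSwinnertonDyer.Rank1Residual.X11b.AcSelmer
open Summit.BirchSwinnertonDyer.Rank1Residual.GaloisImage.EP (forall_localEulerPoincareCharacteristic_adicCompletion)
open Summit.BirchSwinnertonDyer.BirchSwinnertonDyer.Theses.CongruentShaFreeCut
open Summit.BirchSwinnertonDyer.BirchSwinnertonDyer.Theorems.CongruentShaFreeCutTwoAdicLinks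
  (TwoAdicCharValueEqHeegnerLogSq)
open Summit.BirchSwinnertonDyer.BirchSwinnertonDyer.Theorems.CongruentShaFreeCutTwoAdicLinksCorank
  (TwoAdicControlOfCorankOne cruxA_of_twoAdicLinks leaf_of_twoAdicLinks)
open Summit.BirchSwinnertonDyer.BirchSwinnertonDyer.Theorems.CongruentShaFreeCutTwoAdicControlOfSelmerFinite
  (hasCharValuationAt_of_finite_selmerAcBase)
open Summit.BirchSwinnertonDyer.BirchSwinnertonDyer.Theorems.CongruentShaFreeCutLocNonDegeneracy
  (twoLocNonDegeneracy_of_cruxA)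

/-! ## 1. Link A in corank currency from (res) at `2`, algebra and Poitou–Tate -/

/-- **Link A in CORANK currency `TwoAdicControlOfCorankOne` ⟸ (res) at `2` + algebra + Poitou–Tate.**
At a datum (square-free `n`; `K` imaginary quadratic with the Heegner hypothesis for `2`; `v̄ ∋ 2`; `κ`, `γ`;
`corank_{ℤ₂} Sel_{2^∞}(E_n/K) = 1`): (res) at the primes above `2` (`hres`) and the W,p-general algebra
statement (`halg`, Poitou–Tate `hPT`, EPC from the tree) make Castella's `Sel_{v̄}(K, E_n[2^∞])` finite, and
`hasCharValuationAt_of_finite_selmerAcBase (E_n) 2` (p429171) gives `∃ m, HasCharValuationAt … m`.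
CONDITIONAL; credits nothing. [cite: Skinner2020, §2.3 Lemma 2.3.2 (shape)]
[cite: MilneADT2006, Ch. I, Thm. 4.10(b) and Thm. 2.8] -/
theorem twoAdicControlOfCorankOne_of_res_of_poitouTate
    (hPT : ∀ (K : Type) [Field K] [NumberField K], poitouTate_sum_localTatePairing_eq_zero K)
    (halg : ∀ (W : WeierstrassCurve ℚ) [W.IsElliptic] [W.IsGloballyMinimal] (p : ℕ) [Fact p.Prime]
      (K : Type) [Field K] [NumberField K],
      poitouTate_sum_localTatePairing_eq_zero K →
      (∀ v : HeightOneSpectrum (𝓞 K), localEulerPoincareCharacteristic (v.adicCompletion K)) →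
      IsImaginaryQuadratic K → Summit.BirchSwinnertonDyer.Rank1Residual.X11b.SplitsIn K p →
      (W.baseChange K).selmerCorank p = 1 →
      (∀ (w : HeightOneSpectrum (𝓞 K)), ((p : ℕ) : 𝓞 K) ∈ w.asIdeal →
        Finite ↥((W.baseChange K).selmerGroupPInfty p ⊓
          selmerLocalKerPrimaryTorsion (W.baseChange K) (w.adicCompletion K) p)) →
      ∀ (𝔭 : HeightOneSpectrum (𝓞 K)), ((p : ℕ) : 𝓞 K) ∈ 𝔭.asIdeal →
        Finite (Summit.BirchSwinnertonDyer.Rank1Residual.X11b.AcSelmer.selmerAcBase (W.baseChange K) p 𝔭 ∅))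
    (hres : ∀ ⦃n : ℕ⦄, Squarefree n → ∀ (K : Type) [Field K] [NumberField K],
      IsImaginaryQuadratic K → SatisfiesHeegnerHypothesis 2 K →
        ((congruentNumberCurve n).baseChange K).selmerCorank 2 = 1 →
      ∀ (w : HeightOneSpectrum (𝓞 K)), ((2 : ℕ) : 𝓞 K) ∈ w.asIdeal →
        Finite ↥(((congruentNumberCurve n).baseChange K).selmerGroupPInfty 2 ⊓
          selmerLocalKerPrimaryTorsion ((congruentNumberCurve n).baseChange K) (w.adicCompletion K) 2)) :
    TwoAdicControlOfCorankOne := by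
  intro n hn K _ _ N _ _hN hK _hHN hH2 ι v vbar _hv hvbar _hne κ hκ γ _ hcK
  haveI := isElliptic_congruentNumberCurve hn.ne_zero
  haveI := isGloballyMinimal_congruentNumberCurve hn
  have hsplit : SplitsIn K 2 := hH2 2 Fact.out (dvd_refl 2)
  haveI : Finite (selmerAcBase ((congruentNumberCurve n).baseChange K) 2 vbar ∅) :=
    halg (congruentNumberCurve n) 2 K (hPT K) (forall_localEulerPoincareCharacteristic_adicCompletion K) hK
      hsplit hcK (hres hn K hK hH2 hcK) vbar hvbar
  exact hasCharValuationAt_of_finite_selmerAcBase (congruentNumberCurve n) 2 hK hsplit κ hκ γ vbar hvbar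

/-! ## 2. Crux A ⟺ (res) at `2`, modulo Link B, Poitou–Tate, algebra and the refereed facts -/

/-- **Crux A `RankPosOfTwoSelmerCorankOne` from (res) at `2`, Link B, algebra, Poitou–Tate and five refereed
facts** (`2`-parity, modularity, Hoffstein–Luo, Kato, Gross 1984): `cruxA_of_twoAdicLinks` (p425532) fed with
`twoAdicControlOfCorankOne_of_res_of_poitouTate`. CONDITIONAL; credits nothing.
[cite: CastellaGrossiLeeSkinner2022, §5.2 (proof of Thm. 5.2.1)] [cite: Skinner2020, Thm. B (shape)] -/
theorem cruxA_of_res_of_linkB_of_poitouTate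
    (hpar : ∀ (W : WeierstrassCurve ℚ) [W.IsElliptic] (p : ℕ) [Fact p.Prime], p_parity W p)
    (hmod : ModularForms.exists_isNewformOf) (hHL : HoffsteinLuo1997_exists_twist_L_one_ne_zero)
    (hKato : ∀ (W : WeierstrassCurve ℚ) [W.IsElliptic] (p : ℕ) [Fact p.Prime],
      kato_finite_of_L_one_ne_zero W p)
    (hHP : ∀ (W : WeierstrassCurve ℚ) (K : Type) [Field K] [NumberField K],
      exists_isHeegnerPoint W K)
    (hPT : ∀ (K : Type) [Field K] [NumberField K], poitouTate_sum_localTatePairing_eq_zero K)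
    (halg : ∀ (W : WeierstrassCurve ℚ) [W.IsElliptic] [W.IsGloballyMinimal] (p : ℕ) [Fact p.Prime]
      (K : Type) [Field K] [NumberField K],
      poitouTate_sum_localTatePairing_eq_zero K →
      (∀ v : HeightOneSpectrum (𝓞 K), localEulerPoincareCharacteristic (v.adicCompletion K)) →
      IsImaginaryQuadratic K → Summit.BirchSwinnertonDyer.Rank1Residual.X11b.SplitsIn K p →
      (W.baseChange K).selmerCorank p = 1 →
      (∀ (w : HeightOneSpectrum (𝓞 K)), ((p : ℕ) : 𝓞 K) ∈ w.asIdeal →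
        Finite ↥((W.baseChange K).selmerGroupPInfty p ⊓
          selmerLocalKerPrimaryTorsion (W.baseChange K) (w.adicCompletion K) p)) →
      ∀ (𝔭 : HeightOneSpectrum (𝓞 K)), ((p : ℕ) : 𝓞 K) ∈ 𝔭.asIdeal →
        Finite (Summit.BirchSwinnertonDyer.Rank1Residual.X11b.AcSelmer.selmerAcBase (W.baseChange K) p 𝔭 ∅))
    (hres : ∀ ⦃n : ℕ⦄, Squarefree n → ∀ (K : Type) [Field K] [NumberField K],
      IsImaginaryQuadratic K → SatisfiesHeegnerHypothesis 2 K →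
        ((congruentNumberCurve n).baseChange K).selmerCorank 2 = 1 →
      ∀ (w : HeightOneSpectrum (𝓞 K)), ((2 : ℕ) : 𝓞 K) ∈ w.asIdeal →
        Finite ↥(((congruentNumberCurve n).baseChange K).selmerGroupPInfty 2 ⊓
          selmerLocalKerPrimaryTorsion ((congruentNumberCurve n).baseChange K) (w.adicCompletion K) 2))
    (hB : TwoAdicCharValueEqHeegnerLogSq) :
    RankPosOfTwoSelmerCorankOne :=
  cruxA_of_twoAdicLinks hpar hmod hHL hKato hHP
    (twoAdicControlOfCorankOne_of_res_of_poitouTate hPT halg hres) hB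

/-- **KERNEL CENSUS of the residual: modulo Link B, Poitou–Tate, the W,p-general algebra statement and the
five refereed facts, crux A `RankPosOfTwoSelmerCorankOne` is EQUIVALENT to (res) at `2`** (the registered
`stub_twoLocNonDegeneracy` statement): `⟸` is `cruxA_of_res_of_linkB_of_poitouTate`, `⟹` the fact-free
`CongruentShaFreeCutLocNonDegeneracy.twoLocNonDegeneracy_of_cruxA`. CONDITIONAL; credits nothing.
[cite: Skinner2020, Thm. B and §2.2 (shape of (res))] [cite: WZhang2014, Thm. 1.3 and Remark 2 (p. 198)] -/
theorem cruxA_iff_res_of_linkB_of_poitouTate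
    (hpar : ∀ (W : WeierstrassCurve ℚ) [W.IsElliptic] (p : ℕ) [Fact p.Prime], p_parity W p)
    (hmod : ModularForms.exists_isNewformOf) (hHL : HoffsteinLuo1997_exists_twist_L_one_ne_zero)
    (hKato : ∀ (W : WeierstrassCurve ℚ) [W.IsElliptic] (p : ℕ) [Fact p.Prime],
      kato_finite_of_L_one_ne_zero W p)
    (hHP : ∀ (W : WeierstrassCurve ℚ) (K : Type) [Field K] [NumberField K],
      exists_isHeegnerPoint W K)
    (hPT : ∀ (K : Type) [Field K] [NumberField K], poitouTate_sum_localTatePairing_eq_zero K)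
    (halg : ∀ (W : WeierstrassCurve ℚ) [W.IsElliptic] [W.IsGloballyMinimal] (p : ℕ) [Fact p.Prime]
      (K : Type) [Field K] [NumberField K],
      poitouTate_sum_localTatePairing_eq_zero K →
      (∀ v : HeightOneSpectrum (𝓞 K), localEulerPoincareCharacteristic (v.adicCompletion K)) →
      IsImaginaryQuadratic K → Summit.BirchSwinnertonDyer.Rank1Residual.X11b.SplitsIn K p →
      (W.baseChange K).selmerCorank p = 1 →
      (∀ (w : HeightOneSpectrum (𝓞 K)), ((p : ℕ) : 𝓞 K) ∈ w.asIdeal →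
        Finite ↥((W.baseChange K).selmerGroupPInfty p ⊓
          selmerLocalKerPrimaryTorsion (W.baseChange K) (w.adicCompletion K) p)) →
      ∀ (𝔭 : HeightOneSpectrum (𝓞 K)), ((p : ℕ) : 𝓞 K) ∈ 𝔭.asIdeal →
        Finite (Summit.BirchSwinnertonDyer.Rank1Residual.X11b.AcSelmer.selmerAcBase (W.baseChange K) p 𝔭 ∅))
    (hB : TwoAdicCharValueEqHeegnerLogSq) :
    RankPosOfTwoSelmerCorankOne ↔
      ∀ ⦃n : ℕ⦄, Squarefree n → ∀ (K : Type) [Field K] [NumberField K],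
        IsImaginaryQuadratic K → SatisfiesHeegnerHypothesis 2 K →
          ((congruentNumberCurve n).baseChange K).selmerCorank 2 = 1 →
        ∀ (w : HeightOneSpectrum (𝓞 K)), ((2 : ℕ) : 𝓞 K) ∈ w.asIdeal →
          Finite ↥(((congruentNumberCurve n).baseChange K).selmerGroupPInfty 2 ⊓
            selmerLocalKerPrimaryTorsion ((congruentNumberCurve n).baseChange K) (w.adicCompletion K) 2) :=
  ⟨fun hA _ hn K _ _ hK hH2 hcK w hw ↦ twoLocNonDegeneracy_of_cruxA hA hn K hK hH2 hcK w hw,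
    fun hres ↦ cruxA_of_res_of_linkB_of_poitouTate hpar hmod hHL hKato hHP hPT halg hres hB⟩

/-! ## 3. The whole rung-S2 leaf from {(res) at `2`, Link B} -/

/-- **The rung-S2 leaf `rankOne_twoConverse_congruentNumber` from (res) at `2`, Link B, algebra,
Poitou–Tate and the six refereed facts** (`2`-parity, modularity, Hoffstein–Luo, Kato, Gross 1984,
Gross–Zagier + Kolyvagin): `leaf_of_twoAdicLinks` (p425532) fed with
`twoAdicControlOfCorankOne_of_res_of_poitouTate`. KERNEL CENSUS of route S2 after v5: leaf ⟸ {(res) at `2`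
[XL, Selmer currency], Link B `TwoAdicCharValueEqHeegnerLogSq` [XL]} + Poitou–Tate [textbook] + the algebra
statement [L, claimed] + six refereed facts. CONDITIONAL; neither BSD nor the congruent number problem is
touched. [cite: GrossZagier1986, Thm. I.6.3 with V.§2] [cite: CastellaGrossiLeeSkinner2022, §5.2 (proof of Thm. 5.2.1)]
[cite: MilneADT2006, Ch. I, Thm. 4.10(b)] -/
theorem leaf_of_res_of_linkB_of_poitouTate
    (hpar : ∀ (W : WeierstrassCurve ℚ) [W.IsElliptic] (p : ℕ) [Fact p.Prime], p_parity W p)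
    (hmod : ModularForms.exists_isNewformOf) (hHL : HoffsteinLuo1997_exists_twist_L_one_ne_zero)
    (hKato : ∀ (W : WeierstrassCurve ℚ) [W.IsElliptic] (p : ℕ) [Fact p.Prime],
      kato_finite_of_L_one_ne_zero W p)
    (hHP : ∀ (W : WeierstrassCurve ℚ) (K : Type) [Field K] [NumberField K],
      exists_isHeegnerPoint W K)
    (hGZ : ∀ (W : WeierstrassCurve ℚ) (N : ℕ) [NeZero N] (K : Type) [Field K] [NumberField K],
      analyticRankEK_eq_one_iff_heegner_nonTorsion W N K)
    (hPT : ∀ (K : Type) [Field K] [NumberField K], poitouTate_sum_localTatePairing_eq_zero K)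
    (halg : ∀ (W : WeierstrassCurve ℚ) [W.IsElliptic] [W.IsGloballyMinimal] (p : ℕ) [Fact p.Prime]
      (K : Type) [Field K] [NumberField K],
      poitouTate_sum_localTatePairing_eq_zero K →
      (∀ v : HeightOneSpectrum (𝓞 K), localEulerPoincareCharacteristic (v.adicCompletion K)) →
      IsImaginaryQuadratic K → Summit.BirchSwinnertonDyer.Rank1Residual.X11b.SplitsIn K p →
      (W.baseChange K).selmerCorank p = 1 →
      (∀ (w : HeightOneSpectrum (𝓞 K)), ((p : ℕ) : 𝓞 K) ∈ w.asIdeal →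
        Finite ↥((W.baseChange K).selmerGroupPInfty p ⊓
          selmerLocalKerPrimaryTorsion (W.baseChange K) (w.adicCompletion K) p)) →
      ∀ (𝔭 : HeightOneSpectrum (𝓞 K)), ((p : ℕ) : 𝓞 K) ∈ 𝔭.asIdeal →
        Finite (Summit.BirchSwinnertonDyer.Rank1Residual.X11b.AcSelmer.selmerAcBase (W.baseChange K) p 𝔭 ∅))
    (hres : ∀ ⦃n : ℕ⦄, Squarefree n → ∀ (K : Type) [Field K] [NumberField K],
      IsImaginaryQuadratic K → SatisfiesHeegnerHypothesis 2 K →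
        ((congruentNumberCurve n).baseChange K).selmerCorank 2 = 1 →
      ∀ (w : HeightOneSpectrum (𝓞 K)), ((2 : ℕ) : 𝓞 K) ∈ w.asIdeal →
        Finite ↥(((congruentNumberCurve n).baseChange K).selmerGroupPInfty 2 ⊓
          selmerLocalKerPrimaryTorsion ((congruentNumberCurve n).baseChange K) (w.adicCompletion K) 2))
    (hB : TwoAdicCharValueEqHeegnerLogSq) :
    rankOne_twoConverse_congruentNumber :=
  leaf_of_twoAdicLinks hpar hmod hHL hKato hHP hGZ
    (twoAdicControlOfCorankOne_of_res_of_poitouTate hPT halg hres) hB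

/-! ## 4. APPEND (2026-08-26, same seat): the algebra statement DISCHARGED — transfer-2 g3 landed the
registered stub as `CongruentShaFreeCutSelmerFiniteOfRes.stub_selmerAcBaseFinite_of_resCorankOne`
(W,p-general; rank dichotomy: Part A outright in rank one, the `p^k ↦ p^∞` bridge in rank zero), so `halg`
is now a tree theorem and every statement of §§1–3 holds WITHOUT it. -/

/-- **Link A in CORANK currency `TwoAdicControlOfCorankOne` ⟸ (res) at `2` + Poitou–Tate** — §1 with
`halg` := the landed `stub_selmerAcBaseFinite_of_resCorankOne`. CONDITIONAL on (res) and PT; credits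
nothing. [cite: Skinner2020, §2.3 Lemma 2.3.2 (shape)] [cite: MilneADT2006, Ch. I, Thm. 4.10(b)] -/
theorem twoAdicControlOfCorankOne_of_res
    (hPT : ∀ (K : Type) [Field K] [NumberField K], poitouTate_sum_localTatePairing_eq_zero K)
    (hres : ∀ ⦃n : ℕ⦄, Squarefree n → ∀ (K : Type) [Field K] [NumberField K],
      IsImaginaryQuadratic K → SatisfiesHeegnerHypothesis 2 K →
        ((congruentNumberCurve n).baseChange K).selmerCorank 2 = 1 →
      ∀ (w : HeightOneSpectrum (𝓞 K)), ((2 : ℕ) : 𝓞 K) ∈ w.asIdeal →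
        Finite ↥(((congruentNumberCurve n).baseChange K).selmerGroupPInfty 2 ⊓
          selmerLocalKerPrimaryTorsion ((congruentNumberCurve n).baseChange K) (w.adicCompletion K) 2)) :
    TwoAdicControlOfCorankOne :=
  twoAdicControlOfCorankOne_of_res_of_poitouTate hPT
    Summit.BirchSwinnertonDyer.BirchSwinnertonDyer.Theorems.CongruentShaFreeCutSelmerFiniteOfRes.stub_selmerAcBaseFinite_of_resCorankOne
    hres

/-- **Crux A ⟸ (res) + Link B + Poitou–Tate + five refereed facts** — §2 with `halg` discharged.
CONDITIONAL; credits nothing. [cite: CastellaGrossiLeeSkinner2022, §5.2 (proof of Thm. 5.2.1)] -/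
theorem cruxA_of_res_of_linkB
    (hpar : ∀ (W : WeierstrassCurve ℚ) [W.IsElliptic] (p : ℕ) [Fact p.Prime], p_parity W p)
    (hmod : ModularForms.exists_isNewformOf) (hHL : HoffsteinLuo1997_exists_twist_L_one_ne_zero)
    (hKato : ∀ (W : WeierstrassCurve ℚ) [W.IsElliptic] (p : ℕ) [Fact p.Prime],
      kato_finite_of_L_one_ne_zero W p)
    (hHP : ∀ (W : WeierstrassCurve ℚ) (K : Type) [Field K] [NumberField K],
      exists_isHeegnerPoint W K)
    (hPT : ∀ (K : Type) [Field K] [NumberField K], poitouTate_sum_localTatePairing_eq_zero K)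
    (hres : ∀ ⦃n : ℕ⦄, Squarefree n → ∀ (K : Type) [Field K] [NumberField K],
      IsImaginaryQuadratic K → SatisfiesHeegnerHypothesis 2 K →
        ((congruentNumberCurve n).baseChange K).selmerCorank 2 = 1 →
      ∀ (w : HeightOneSpectrum (𝓞 K)), ((2 : ℕ) : 𝓞 K) ∈ w.asIdeal →
        Finite ↥(((congruentNumberCurve n).baseChange K).selmerGroupPInfty 2 ⊓
          selmerLocalKerPrimaryTorsion ((congruentNumberCurve n).baseChange K) (w.adicCompletion K) 2))
    (hB : TwoAdicCharValueEqHeegnerLogSq) :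
    RankPosOfTwoSelmerCorankOne :=
  cruxA_of_res_of_linkB_of_poitouTate hpar hmod hHL hKato hHP hPT
    Summit.BirchSwinnertonDyer.BirchSwinnertonDyer.Theorems.CongruentShaFreeCutSelmerFiniteOfRes.stub_selmerAcBaseFinite_of_resCorankOne
    hres hB

/-- **KERNEL CENSUS, final form: modulo Link B, Poitou–Tate and the five refereed facts, crux A
⟺ (res) at `2`** (the registered `stub_twoLocNonDegeneracy` statement) — §2 with `halg` discharged by the
landed algebra theorem. The residual's research content is ONE Selmer-only statement + Link B.
CONDITIONAL; credits nothing. [cite: Skinner2020, Thm. B and §2.2 (shape of (res))]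
[cite: WZhang2014, Thm. 1.3 and Remark 2 (p. 198)] -/
theorem cruxA_iff_res_of_linkB
    (hpar : ∀ (W : WeierstrassCurve ℚ) [W.IsElliptic] (p : ℕ) [Fact p.Prime], p_parity W p)
    (hmod : ModularForms.exists_isNewformOf) (hHL : HoffsteinLuo1997_exists_twist_L_one_ne_zero)
    (hKato : ∀ (W : WeierstrassCurve ℚ) [W.IsElliptic] (p : ℕ) [Fact p.Prime],
      kato_finite_of_L_one_ne_zero W p)
    (hHP : ∀ (W : WeierstrassCurve ℚ) (K : Type) [Field K] [NumberField K],
      exists_isHeegnerPoint W K)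
    (hPT : ∀ (K : Type) [Field K] [NumberField K], poitouTate_sum_localTatePairing_eq_zero K)
    (hB : TwoAdicCharValueEqHeegnerLogSq) :
    RankPosOfTwoSelmerCorankOne ↔
      ∀ ⦃n : ℕ⦄, Squarefree n → ∀ (K : Type) [Field K] [NumberField K],
      IsImaginaryQuadratic K → SatisfiesHeegnerHypothesis 2 K →
        ((congruentNumberCurve n).baseChange K).selmerCorank 2 = 1 →
      ∀ (w : HeightOneSpectrum (𝓞 K)), ((2 : ℕ) : 𝓞 K) ∈ w.asIdeal →
        Finite ↥(((congruentNumberCurve n).baseChange K).selmerGroupPInfty 2 ⊓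
          selmerLocalKerPrimaryTorsion ((congruentNumberCurve n).baseChange K) (w.adicCompletion K) 2) :=
  cruxA_iff_res_of_linkB_of_poitouTate hpar hmod hHL hKato hHP hPT
    Summit.BirchSwinnertonDyer.BirchSwinnertonDyer.Theorems.CongruentShaFreeCutSelmerFiniteOfRes.stub_selmerAcBaseFinite_of_resCorankOne
    hB

/-- **The leaf ⟸ {(res) at `2`, Link B} + Poitou–Tate + the six refereed facts** — §3 with `halg`
discharged. KERNEL CENSUS of the route after v5 + the algebra landing: research = (res) [XL, Selmer
currency] + Link B [XL]; textbook = Poitou–Tate; refereed = six named facts. CONDITIONAL; BSD untouched.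
[cite: GrossZagier1986, Thm. I.6.3 with V.§2] [cite: CastellaGrossiLeeSkinner2022, §5.2 (proof of Thm. 5.2.1)] -/
theorem leaf_of_res_of_linkB
    (hpar : ∀ (W : WeierstrassCurve ℚ) [W.IsElliptic] (p : ℕ) [Fact p.Prime], p_parity W p)
    (hmod : ModularForms.exists_isNewformOf) (hHL : HoffsteinLuo1997_exists_twist_L_one_ne_zero)
    (hKato : ∀ (W : WeierstrassCurve ℚ) [W.IsElliptic] (p : ℕ) [Fact p.Prime],
      kato_finite_of_L_one_ne_zero W p)
    (hHP : ∀ (W : WeierstrassCurve ℚ) (K : Type) [Field K] [NumberField K],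
      exists_isHeegnerPoint W K)
    (hGZ : ∀ (W : WeierstrassCurve ℚ) (N : ℕ) [NeZero N] (K : Type) [Field K] [NumberField K],
      analyticRankEK_eq_one_iff_heegner_nonTorsion W N K)
    (hPT : ∀ (K : Type) [Field K] [NumberField K], poitouTate_sum_localTatePairing_eq_zero K)
    (hres : ∀ ⦃n : ℕ⦄, Squarefree n → ∀ (K : Type) [Field K] [NumberField K],
      IsImaginaryQuadratic K → SatisfiesHeegnerHypothesis 2 K →
        ((congruentNumberCurve n).baseChange K).selmerCorank 2 = 1 →
      ∀ (w : HeightOneSpectrum (𝓞 K)), ((2 : ℕ) : 𝓞 K) ∈ w.asIdeal →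
        Finite ↥(((congruentNumberCurve n).baseChange K).selmerGroupPInfty 2 ⊓
          selmerLocalKerPrimaryTorsion ((congruentNumberCurve n).baseChange K) (w.adicCompletion K) 2))
    (hB : TwoAdicCharValueEqHeegnerLogSq) :
    rankOne_twoConverse_congruentNumber :=
  leaf_of_res_of_linkB_of_poitouTate hpar hmod hHL hKato hHP hGZ hPT
    Summit.BirchSwinnertonDyer.BirchSwinnertonDyer.Theorems.CongruentShaFreeCutSelmerFiniteOfRes.stub_selmerAcBaseFinite_of_resCorankOne
    hres hB

end Summit.BirchSwinnertonDyer.BirchSwinnertonDyer.Theorems.CongruentShaFreeCutResidualCensus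

end
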